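/- Copyright: the b2b-balaban cell (near-miss cell 7), T⁴-continuum fan-out, NE7b crux team (2), leaf lineage
t4-ne7b-formalise-leaf-05 on the owner's INTERFACE REQUEST NE7b IR-41-7 (i).  Released under the licence of the
surrounding project. -/
import Summits.QuantumFields.BalabanUV.T4Continuum.Support.HistoryGenealogyRealiseR
import Summits.QuantumFields.BalabanUV.T4Continuum.Support.HistoryRealiseWeak

/-!
# Genealogy REALISATION for the per-part-renewal extraction `pgenR`, MEMORY-AGNOSTIC FORM (the W-twin of row S14-R
over the repair core R-41-a `HistoryRealiseWeak.RealisesW`; INTERFACE REQUEST NE7b IR-41-7 (i) of the row-NE7b OWNER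
t4-ne7b-p1 gen 41, HOME/INBOX.md «RULINGS R-OWNER-41-1…-4 + INTERFACE REQUESTS IR-41-1…-7»; filed by leaf lineage
t4-ne7b-formalise-leaf-05 — PRE-POSITIONING ONLY)

Summits-side support leaf of the T⁴-continuum cell (rung (B)+1 on a FINITE torus only; NOT infinite volume, NOT the
mass gap, NOT the Clay statement; NOT a proof of the spine estimate NE7b, which is the cell's OWN estimate, NOT PRINTED
and NOT PROVED).  [folklore] finite combinatorics in the ℤᵈ index model over row S14-R (`HistoryGenealogyRealiseR`:
`LevelClausesR`, `edomR`, `lonePartR`, `cpairR`, `cpair0R`, `constituentsR_eq_map_cpairR`), row S14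
(`ChainTouch`, `unionL`, `img`, `imgC`, `orbit_level_succ`, `map_sum_elim_of_lefts_eq_nil`, `exists_inr_of_lefts_eq_nil`),
the print-exact twin (`pendingBefore_self`) and the memory-agnostic core `HistoryRealiseWeak` (`RealisesW`); nothing
printed is asserted, no `def … : Prop` fact of Bałaban's, no cite-tagged hypothesis, zero `sorry`.  B16 =
[Balaban1989LargeFieldII] pp. 381–387 and B15 = [Balaban1989LargeFieldI] pp. 177, 198 are manuscripts UNDER AUDIT;
locators only (C-B16-6).

WHY (located model finding F-ne7bleaf01g24-1, ruling R-OWNER-41-1, repair route R-41-a).  Row S14-R's displayed clause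
(G-readyR) asks a FROZEN-memory stop `Stops L s R t (edomR j p) (j − t)` at the renewal scale; print reads condition
(ii)'s memory at the level the readiness test is made (B16 p. 384 «with N = R_j»; B15 p. 198), and R drops along a run
(B15 p. 177).  The core `RealisesW` removes the convention from the predicate: a renewal needs only `t < j`, condition
(i) of the image at `j`, and frozen-memory pendency strictly before.  THIS FILE is the process-side half over the
per-part-renewal extraction: the clause (G-readyR) is weakened to exactly those three facts (**`LevelClausesW`**), every
other clause is `LevelClausesR`'s token for token, and the realisation theorem is re-proved in the W currency.  Every
readiness convention whose memory is at most the frozen one (the landed S15 process; print's current-memory process of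
IR-41-7 (ii)) instantiates `LevelClausesW`.  BY-NAME EFFECT ON THE WALL: NONE (pre-positioning for (α) + R-41-a).

WHAT IS DEFINED AND PROVED.  §1 **`realisesW_joinTail`**, **`realisesW_assembleR_of_two_le`** (join chains realised in
the W currency; partners `PendingBefore … sj` as in the print-exact twin).  §2 **`structure
GeomHistoryR.LevelClausesW H rnw dom L s R : Prop`**, **`GeomHistoryR.levelClausesW_of_levelClausesR`**.  §3
`realisesW_birth_of_new_ok`, **`realisesW_pgenR`** (under `WF` + `LevelClausesW`: ∀ c ∈ comp j,
`RealisesW L s R (H.pgenR rnw j c) (edomR H rnw dom j c)` ∧ `dom j c = orbit L s (H.pgenR rnw j c).lastStep (edomR … j c)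
(j − lastStep)`), `realisesW_of_mem_compR`, `dom_eq_orbitW`, `disjoint_orbit_of_disjoint_domW`, `adm_of_mem_compW`.
§4 sanity: the R clauses give the W conclusion (`realisesW_pgenR_of_levelClausesR`), by two routes.

SHAPE NOTE (statement-first, for the owner).  The request text reads «a flagged part `p` of level `j` satisfies
`(pgenR j p).lastStep < j + 1`»; the renewal booked by `pgenR` is `renew (pgenR j p) j` (readiness index `h = j`,
`HistoryGenealogyExtractionR.pgenR_succ_renew`), and `RealisesW`'s renewal clause at `h = j` asks `lastStep < j`
(= `(Stops …).pos` of (G-readyR)) — so (G-readyW) is typed with `< j`.  «NOT THIS SHAPE» re-cuts it.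

HONEST.  Proves nothing of Bałaban's; the clauses are OUR reading, displayed; NE7b NOT proved; spine 0∕9.  HONEST
DEPENDENCY (cell): continuum YM on T⁴ ⇐ BetaPertH ∧ nine spine estimates (0/9 proved); BetaPertH ⇐ (D1) ∧ (D4) ∧
CAP+tail; G-an2-4 gates asym, D1 and NE2/3/4.  This file changes none of it. -/

open Finset
open Literature.MathematicalPhysics.QuantumFieldTheory.Balaban1983to89
open Literature.MathematicalPhysics.QuantumFieldTheory.Balaban1983to89.B13ScaleTransfer
open Literature.MathematicalPhysics.QuantumFieldTheory.Balaban1983to89.TreeLength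
open Literature.MathematicalPhysics.QuantumFieldTheory.Balaban1983to89.B16SProfile
open Literature.MathematicalPhysics.QuantumFieldTheory.Balaban1983to89.B16StoppingRule
open Literature.MathematicalPhysics.QuantumFieldTheory.Balaban1983to89.B16MergeGeometry
open Summit.QuantumFields.BalabanUV.T4Continuum.HistoryAdmissible
open Summit.QuantumFields.BalabanUV.T4Continuum.HistoryAdmissible.PGen
open Summit.QuantumFields.BalabanUV.T4Continuum.HistoryRealise
open Summit.QuantumFields.BalabanUV.T4Continuum.HistoryRealisePrint
open Summit.QuantumFields.BalabanUV.T4Continuum.HistoryRealiseWeak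
open Summit.QuantumFields.BalabanUV.T4Continuum.HistoryGenealogyExtraction

namespace Summit.QuantumFields.BalabanUV.T4Continuum.HistoryGenealogyRealise

noncomputable section

variable {d : ℕ}

/-! ## §1 Join chains realised, memory-agnostic currency -/

section JoinChainW

variable {L : ℕ} {s R : ℕ → ℕ}

/-- **JOIN CHAINS REALISED, W CURRENCY.**  Head `T` weakly realised by `ZT` and further constituents `Us` (each weakly
realised by its listed domain), all with `lastStep ≤ sj` and pending STRICTLY BEFORE `sj`, listed so that each image
touches the union of the later images, and a domain `Z` inside the union of all images ⟹
`RealisesW (joinTail T (Us.map Prod.fst) sj) Z` (the join clause of `RealisesW` is `RealisesP`'s token for token).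
[folklore] -/
theorem realisesW_joinTail (sj : ℕ) :
    ∀ (T : PGen (Lab d)) (ZT : Finset (Pt d)) (Us : List (PGen (Lab d) × Finset (Pt d))), Us ≠ [] →
      RealisesW L s R T ZT → T.lastStep ≤ sj → PendingBefore L s R T.lastStep ZT sj →
      (∀ UZ ∈ Us, RealisesW L s R UZ.1 UZ.2 ∧ UZ.1.lastStep ≤ sj ∧ PendingBefore L s R UZ.1.lastStep UZ.2 sj) →
      ChainTouch (img L s sj (T, ZT) :: Us.map (img L s sj)) →
      ∀ Z, Z ⊆ unionL (img L s sj (T, ZT) :: Us.map (img L s sj)) →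
        RealisesW L s R (joinTail T (Us.map Prod.fst) sj) Z
  | _, _, [], hne, _, _, _, _, _, _, _ => (hne rfl).elim
  | T, ZT, [UZ], _, hT, hTs, hTp, hall, hct, Z, hZ => by
      obtain ⟨hU, hUs, hUp⟩ := hall UZ (by simp)
      have hct' : ChainTouch [img L s sj (T, ZT), img L s sj UZ] := by
        simpa only [List.map_cons, List.map_nil] using hct
      obtain ⟨⟨a, ha, c, hc, hac⟩, -⟩ := (chainTouch_cons_cons _ _ _).1 hct'
      have hc' : c ∈ img L s sj UZ := by simpa using hc
      have hZ' : Z ⊆ img L s sj (T, ZT) ∪ img L s sj UZ := by simpa using hZ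
      show RealisesW L s R (PGen.join T UZ.1 sj) Z
      exact ⟨ZT, UZ.2, hT, hU, hTs, hUs, hTp, hUp, ⟨a, ha, c, hc', hac⟩, hZ'⟩
  | T, ZT, UZ :: VZ :: Us, _, hT, hTs, hTp, hall, hct, Z, hZ => by
      obtain ⟨hU, hUs, hUp⟩ := hall UZ (by simp)
      have hct' : ChainTouch (img L s sj (T, ZT) :: img L s sj UZ :: (VZ :: Us).map (img L s sj)) := by
        simpa using hct
      obtain ⟨⟨a, ha, c, hc, hac⟩, hrest⟩ := (chainTouch_cons_cons _ _ _).1 hct'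
      -- the rest of the chain, weakly realised by the union of its images
      set ZJ : Finset (Pt d) := unionL (img L s sj UZ :: (VZ :: Us).map (img L s sj)) with hZJ
      have hJ : RealisesW L s R (joinTail UZ.1 ((VZ :: Us).map Prod.fst) sj) ZJ :=
        realisesW_joinTail sj UZ.1 UZ.2 (VZ :: Us) (by simp) hU hUs hUp
          (fun W hW => hall W (by simp only [List.mem_cons] at hW ⊢; exact Or.inr hW)) (by simpa using hrest)
          ZJ subset_rfl
      have hlast : (joinTail UZ.1 ((VZ :: Us).map Prod.fst) sj).lastStep = sj := by
        simp [lastStep]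
      show RealisesW L s R (PGen.join T (joinTail UZ.1 (VZ.1 :: Us.map Prod.fst) sj) sj) Z
      have hmap : (VZ :: Us).map Prod.fst = VZ.1 :: Us.map Prod.fst := rfl
      rw [← hmap]
      refine ⟨ZT, ZJ, hT, hJ, hTs, hlast.le, hTp, ?_, ⟨a, ha, c, ?_, hac⟩, ?_⟩
      · rw [hlast]; exact pendingBefore_self L s R sj ZJ
      · rw [hlast, Nat.sub_self, orbit_zero]
        simpa [hZJ] using hc
      · rw [hlast, Nat.sub_self, orbit_zero]
        intro x hx
        have hx' := hZ hx
        simp only [unionL_cons, List.map_cons, Finset.mem_union] at hx' ⊢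
        simpa [img, hZJ, or_assoc] using hx'

/-- **`assembleR`, JOIN BRANCH, REALISED, W CURRENCY**: ≥ 2 constituents listed with their domains, each weakly
realised with `lastStep ≤ sj` and `PendingBefore … sj`, images in `ChainTouch` order ⟹ the assembled genealogy is
weakly realised by any domain inside the union of the images, and its last step is `sj`. [folklore] -/
theorem realisesW_assembleR_of_two_le (c : Lab d) (sj : ℕ) (Ps : List (PGen (Lab d) × Finset (Pt d)))
    (h2 : 2 ≤ Ps.length)
    (hall : ∀ UZ ∈ Ps, RealisesW L s R UZ.1 UZ.2 ∧ UZ.1.lastStep ≤ sj ∧ PendingBefore L s R UZ.1.lastStep UZ.2 sj)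
    (hct : ChainTouch (Ps.map (img L s sj))) {Z : Finset (Pt d)} (hZ : Z ⊆ unionL (Ps.map (img L s sj))) :
    RealisesW L s R (assembleR c sj (Ps.map Prod.fst)) Z ∧ (assembleR c sj (Ps.map Prod.fst)).lastStep = sj := by
  match Ps, h2, hall, hct, hZ with
  | [], h2, _, _, _ => simp at h2
  | [_], h2, _, _, _ => simp at h2
  | TZ :: UZ :: Us, _, hall, hct, hZ =>
      obtain ⟨hT, hTs, hTp⟩ := hall TZ (by simp)
      simp only [List.map_cons, assembleR_cons_cons]
      refine ⟨?_, rfl⟩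
      have hmap : UZ.1 :: Us.map Prod.fst = (UZ :: Us).map Prod.fst := rfl
      rw [hmap]
      exact realisesW_joinTail sj TZ.1 TZ.2 (UZ :: Us) (by simp) hT hTs hTp
        (fun W hW => hall W (by simp only [List.mem_cons] at hW ⊢; exact Or.inr hW)) (by simpa using hct) Z
        (by simpa using hZ)

end JoinChainW

/-! ## §2 The displayed clauses with the memory-agnostic renewal clause -/

namespace GeomHistoryR

variable (H : ComponentHistory (Lab d)) (rnw : ℕ → Lab d → Bool) (dom : ℕ → Lab d → Finset (Pt d))
variable (L : ℕ) (s R : ℕ → ℕ)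

/-- **THE DISPLAYED PER-LEVEL GEOMETRIC CLAUSES for the per-part-renewal extraction, MEMORY-AGNOSTIC RENEWAL CLAUSE**
(OUR reading of B16 pp. 381–387 with B15 pp. 177, 198; hypothesis SHAPE, never asserted): `LevelClausesR` with
(G-readyR) weakened to **(G-readyW)** — a part FLAGGED at level `j` (renewed by 𝐑^{(j)}) has its last event strictly
before `j`, its image at `j` satisfies condition (i) (`CondI 100`), and it did not stop (frozen memory) at any index
`< j − lastStep`; which readiness CONVENTION declared it ready is not recorded.  (G-new), (G-birth), (G-flow),
(G-pendR), (G-touch), (G-join) verbatim. [folklore] -/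
structure LevelClausesW : Prop where
  /-- (G-new) new regions: anchored, face-connected, class at least the tree length -/
  new_ok : ∀ j, ∀ n ∈ H.newReg j, n.1 ∈ n.2 ∧ FaceConnected n.2 ∧ treeLen n.2 ≤ H.cls n
  /-- (G-birth) a lone new region is its component's domain -/
  dom_birth : ∀ j c n, c ∈ H.comp j → H.constit j c = [Sum.inr n] → dom j c = n.2
  /-- (G-flow) a component continued alone (renewed or not) flows by one S-operation -/
  dom_flow : ∀ j c p, c ∈ H.comp (j + 1) → H.constit (j + 1) c = [Sum.inl p] →
    dom (j + 1) c = Sop (ratio L s j) (dom j p)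
  /-- (G-readyW) a flagged part: last event strictly before `j`, condition (i) at `j`, frozen pendency before -/
  ready : ∀ j c, c ∈ H.comp (j + 1) → ∀ p ∈ H.parts (j + 1) c, rnw j p = true →
    (H.pgenR rnw j p).lastStep < j ∧
      CondI 100 (orbit L s (H.pgenR rnw j p).lastStep (edomR H rnw dom j p) (j - (H.pgenR rnw j p).lastStep)) ∧
      ∀ k, k < j - (H.pgenR rnw j p).lastStep → ¬ Stops L s R (H.pgenR rnw j p).lastStep (edomR H rnw dom j p) k
  /-- (G-pendR) an unflagged old part of a joined component is pending strictly before the join step -/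
  pend : ∀ j c, c ∈ H.comp (j + 1) → 2 ≤ (H.constit (j + 1) c).length → ∀ p ∈ H.parts (j + 1) c, rnw j p = false →
    PendingBefore L s R (H.pgenR rnw j p).lastStep (edomR H rnw dom j p) (j + 1)
  /-- (G-touch) leaf-first order: each image touches the union of the later images -/
  touch : ∀ j c, c ∈ H.comp j → 2 ≤ (H.constit j c).length → ChainTouch ((H.constit j c).map (imgC L s dom j))
  /-- (G-join) the joined domain lies inside the union of the images -/
  dom_join : ∀ j c, c ∈ H.comp j → 2 ≤ (H.constit j c).length → dom j c ⊆ unionL ((H.constit j c).map (imgC L s dom j))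

variable {H rnw dom L s R}

/-- **THE PRINT-EXACT CLAUSES IMPLY THE MEMORY-AGNOSTIC ONES** (a frozen-memory stop at `j − t` gives `t < j` and
condition (i) there). [folklore] -/
theorem levelClausesW_of_levelClausesR (hG : LevelClausesR H rnw dom L s R) : LevelClausesW H rnw dom L s R where
  new_ok := hG.new_ok
  dom_birth := hG.dom_birth
  dom_flow := hG.dom_flow
  ready j c hc p hp hf := by
    obtain ⟨hstop, hfirst⟩ := hG.ready j c hc p hp hf
    have := hstop.pos
    exact ⟨by omega, hstop.condI, hfirst⟩
  pend := hG.pend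
  touch := hG.touch
  dom_join := hG.dom_join

end GeomHistoryR

/-! ## §3 The realisation theorem for `pgenR`, memory-agnostic form -/

section MainW

open GeomHistoryR ComponentHistory

variable {L : ℕ} {s R : ℕ → ℕ} {H : ComponentHistory (Lab d)} {rnw : ℕ → Lab d → Bool}
  {dom : ℕ → Lab d → Finset (Pt d)}

/-- a new region, under (G-new), is weakly realised by itself as a birth at any step (births are verbatim) [folklore] -/
theorem realisesW_birth_of_new_ok {n : Lab d} (hn : n.1 ∈ n.2 ∧ FaceConnected n.2 ∧ treeLen n.2 ≤ H.cls n) (j : ℕ) :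
    RealisesW L s R (PGen.birth j (H.cls n) n) n.2 :=
  ⟨rfl, hn.1, hn.2.1, hn.2.2⟩

/-- **THE REALISATION THEOREM FOR `pgenR`, MEMORY-AGNOSTIC FORM.**  Under `WF` and the displayed clauses
`LevelClausesW`, every extracted genealogy is `RealisesW`-realised by its last-event domain and the current domain is
the orbit of the last-event domain from the last step (induction on the level: lone unflagged part — inherited; lone
flagged part — renewal by (G-flow) + (G-readyW); lone birth; ≥ 2 constituents — the join chain with flagged parts
renewed (pending at their own step), unflagged parts by (G-pendR), births pending trivially, (G-touch), (G-join)).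
[folklore] -/
theorem realisesW_pgenR (hW : H.WF) (hG : LevelClausesW H rnw dom L s R) :
    ∀ (j : ℕ) (c : Lab d), c ∈ H.comp j →
      RealisesW L s R (H.pgenR rnw j c) (edomR H rnw dom j c) ∧
        dom j c = orbit L s (H.pgenR rnw j c).lastStep (edomR H rnw dom j c) (j - (H.pgenR rnw j c).lastStep)
  | 0, c, hc => by
      have hl0 : lefts (H.constit 0 c) = [] := hW.parts_zero c
      have hne : H.constit 0 c ≠ [] := hW.nonempty 0 c hc
      have hmem : ∀ x ∈ H.constit 0 c, ∃ n, x = Sum.inr n ∧ n ∈ H.newReg 0 := by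
        intro x hx
        obtain ⟨n, rfl⟩ := exists_inr_of_lefts_eq_nil hl0 x hx
        exact ⟨n, rfl, hW.news_sub 0 c hc n ((mem_rights_iff n _).2 hx)⟩
      have hbirths : H.births 0 c = ((H.constit 0 c).map (cpair0R H rnw dom)).map Prod.fst := by
        rw [List.map_map]
        unfold ComponentHistory.births ComponentHistory.news
        rw [show Prod.fst ∘ cpair0R H rnw dom = Sum.elim (fun p => H.pgenR rnw 0 p) fun n => PGen.birth 0 (H.cls n) n
          from funext fun x => by cases x <;> rfl, map_sum_elim_of_lefts_eq_nil _ _ _ hl0]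
      match hcs : H.constit 0 c, hne, hmem with
      | [], hne, _ => exact (hne rfl).elim
      | [x], _, hmem =>
          obtain ⟨n, rfl, hn⟩ := hmem x (by simp)
          rw [H.pgenR_zero_birth rnw c n hcs, edomR_zero, hG.dom_birth 0 c n hc hcs]
          exact ⟨realisesW_birth_of_new_ok (hG.new_ok 0 n hn) 0, by simp [lastStep]⟩
      | x :: y :: l, _, hmem =>
          have h2 : 2 ≤ (H.constit 0 c).length := by rw [hcs]; simp
          have himg : ((H.constit 0 c).map (cpair0R H rnw dom)).map (img L s 0) =
              (H.constit 0 c).map (imgC L s dom 0) := by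
            rw [List.map_map]
            refine List.map_congr_left fun z hz => ?_
            obtain ⟨n, rfl, -⟩ := hmem z (hcs ▸ hz)
            simp [cpair0R, img, lastStep]
          have hall : ∀ UZ ∈ (H.constit 0 c).map (cpair0R H rnw dom),
              RealisesW L s R UZ.1 UZ.2 ∧ UZ.1.lastStep ≤ 0 ∧ PendingBefore L s R UZ.1.lastStep UZ.2 0 := by
            intro UZ hUZ
            obtain ⟨z, hz, rfl⟩ := List.mem_map.1 hUZ
            obtain ⟨n, rfl, hn⟩ := hmem z (hcs ▸ hz)
            exact ⟨realisesW_birth_of_new_ok (hG.new_ok 0 n hn) 0, le_rfl, pendingBefore_self L s R 0 _⟩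
          have hct : ChainTouch (((H.constit 0 c).map (cpair0R H rnw dom)).map (img L s 0)) := by
            rw [himg]; exact hG.touch 0 c hc h2
          have hZ : dom 0 c ⊆ unionL (((H.constit 0 c).map (cpair0R H rnw dom)).map (img L s 0)) := by
            rw [himg]; exact hG.dom_join 0 c hc h2
          have hlen : 2 ≤ ((H.constit 0 c).map (cpair0R H rnw dom)).length := by simpa using h2
          obtain ⟨hR, hlast⟩ := realisesW_assembleR_of_two_le (L := L) (s := s) (R := R) c 0 _ hlen hall hct hZ
          rw [pgenR_zero_eq, hbirths, edomR_zero]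
          exact ⟨hR, by rw [hlast]; simp⟩
  | j + 1, c, hc => by
      have hne : H.constit (j + 1) c ≠ [] := hW.nonempty (j + 1) c hc
      have ih : ∀ p ∈ H.parts (j + 1) c,
          RealisesW L s R (H.pgenR rnw j p) (edomR H rnw dom j p) ∧
            dom j p = orbit L s (H.pgenR rnw j p).lastStep (edomR H rnw dom j p) (j - (H.pgenR rnw j p).lastStep) :=
        fun p hp => realisesW_pgenR hW hG j p (hW.parts_sub j c hc p hp)
      -- the image of an old part at level `j + 1` is one S-operation of its level-`j` domain
      have himgp : ∀ p ∈ H.parts (j + 1) c,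
          orbit L s (H.pgenR rnw j p).lastStep (edomR H rnw dom j p) (j + 1 - (H.pgenR rnw j p).lastStep) =
            Sop (ratio L s j) (dom j p) := by
        intro p hp
        rw [(ih p hp).2, orbit_level_succ L s (H.lastStep_pgenR_le rnw j p)]
      match hcs : H.constit (j + 1) c, hne with
      | [], hne => exact (hne rfl).elim
      | [Sum.inl p], _ =>
          have hp : p ∈ H.parts (j + 1) c := by simp [ComponentHistory.parts, hcs]
          have hflow := hG.dom_flow j c p hc hcs
          cases hf : rnw j p with
          | false =>
              -- LONE UNFLAGGED PART: no event, inherited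
              rw [H.pgenR_succ_lone rnw j c p hcs hf, edomR_succ_lone H rnw dom hcs hf]
              refine ⟨(ih p hp).1, ?_⟩
              rw [hflow, ← himgp p hp]
          | true =>
              -- LONE FLAGGED PART: renewal, memory-agnostic clause
              obtain ⟨hlt, hI, hfirst⟩ := hG.ready j c hc p hp hf
              have hev : edomR H rnw dom (j + 1) c = dom (j + 1) c :=
                edomR_succ_event H rnw dom (by simp [lonePartR, hcs, hf])
              rw [H.pgenR_succ_renew rnw j c p hcs hf, hev]
              refine ⟨⟨edomR H rnw dom j p, (ih p hp).1, hlt, hI, hfirst, ?_⟩, by simp [lastStep]⟩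
              rw [hflow, ← himgp p hp]
      | [Sum.inr n], _ =>
          -- LONE BIRTH
          have hn : n ∈ H.newReg (j + 1) := hW.news_sub (j + 1) c hc n (by simp [ComponentHistory.news, hcs])
          have hev : edomR H rnw dom (j + 1) c = dom (j + 1) c := edomR_succ_event H rnw dom (by simp [lonePartR, hcs])
          rw [H.pgenR_succ_birth rnw j c n hcs, hev, hG.dom_birth (j + 1) c n hc hcs]
          exact ⟨realisesW_birth_of_new_ok (hG.new_ok (j + 1) n hn) (j + 1), by simp [lastStep]⟩
      | x :: y :: l, _ =>
          -- JOIN CHAIN at step j + 1: flagged parts renewed, unflagged parts bare, births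
          have h2 : 2 ≤ (H.constit (j + 1) c).length := by rw [hcs]; simp
          have hev : edomR H rnw dom (j + 1) c = dom (j + 1) c := edomR_succ_event H rnw dom (by simp [lonePartR, hcs])
          have himg : ((H.constit (j + 1) c).map (cpairR H rnw dom L s j)).map (img L s (j + 1)) =
              (H.constit (j + 1) c).map (imgC L s dom (j + 1)) := by
            rw [List.map_map]
            refine List.map_congr_left fun z hz => ?_
            cases z with
            | inl p =>
                have hp : p ∈ H.parts (j + 1) c := (mem_lefts_iff p _).2 hz
                by_cases hf : rnw j p = true
                · simp [cpairR, hf, img, lastStep]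
                · simpa [cpairR, hf, img] using himgp p hp
            | inr n => simp [cpairR, img, lastStep]
          have hall : ∀ UZ ∈ (H.constit (j + 1) c).map (cpairR H rnw dom L s j),
              RealisesW L s R UZ.1 UZ.2 ∧ UZ.1.lastStep ≤ j + 1 ∧ PendingBefore L s R UZ.1.lastStep UZ.2 (j + 1) := by
            intro UZ hUZ
            obtain ⟨z, hz, rfl⟩ := List.mem_map.1 hUZ
            cases z with
            | inl p =>
                have hp : p ∈ H.parts (j + 1) c := (mem_lefts_iff p _).2 hz
                by_cases hf : rnw j p = true
                · -- renewed at `j`, merged at `j + 1`: weakly realised by its S-image, pending at its own step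
                  obtain ⟨hlt, hI, hfirst⟩ := hG.ready j c hc p hp hf
                  simp only [cpairR, Sum.elim_inl, hf, if_true]
                  refine ⟨⟨edomR H rnw dom j p, (ih p hp).1, hlt, hI, hfirst, (himgp p hp).symm⟩, le_rfl, ?_⟩
                  exact pendingBefore_self L s R (j + 1) _
                · have hf' : rnw j p = false := by simpa using hf
                  simp only [cpairR, Sum.elim_inl, hf]
                  exact ⟨(ih p hp).1, (H.lastStep_pgenR_le rnw j p).trans (Nat.le_succ j),
                    hG.pend j c hc h2 p hp hf'⟩
            | inr n =>
                have hn : n ∈ H.newReg (j + 1) := hW.news_sub (j + 1) c hc n ((mem_rights_iff n _).2 hz)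
                exact ⟨realisesW_birth_of_new_ok (hG.new_ok (j + 1) n hn) (j + 1), le_rfl,
                  pendingBefore_self L s R (j + 1) _⟩
          have hct : ChainTouch (((H.constit (j + 1) c).map (cpairR H rnw dom L s j)).map (img L s (j + 1))) := by
            rw [himg]; exact hG.touch (j + 1) c hc h2
          have hZ : dom (j + 1) c ⊆
              unionL (((H.constit (j + 1) c).map (cpairR H rnw dom L s j)).map (img L s (j + 1))) := by
            rw [himg]; exact hG.dom_join (j + 1) c hc h2
          have hlen : 2 ≤ ((H.constit (j + 1) c).map (cpairR H rnw dom L s j)).length := by simpa using h2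
          obtain ⟨hR, hlast⟩ := realisesW_assembleR_of_two_le (L := L) (s := s) (R := R) c (j + 1) _ hlen hall hct hZ
          rw [pgenR_succ_eq, constituentsR_eq_map_cpairR (dom := dom) (L := L) (s := s), hev]
          exact ⟨hR, by rw [hlast]; simp⟩

/-- **EVERY COMPONENT'S `pgenR` GENEALOGY IS WEAKLY REALISED by its last-event domain.** [folklore] -/
theorem realisesW_of_mem_compR (hW : H.WF) (hG : LevelClausesW H rnw dom L s R) {j : ℕ} {c : Lab d}
    (hc : c ∈ H.comp j) : RealisesW L s R (H.pgenR rnw j c) (edomR H rnw dom j c) :=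
  (realisesW_pgenR hW hG j c hc).1

/-- **THE CURRENT DOMAIN IS THE ORBIT OF THE LAST-EVENT DOMAIN** (`pgenR`, W form). [folklore] -/
theorem dom_eq_orbitW (hW : H.WF) (hG : LevelClausesW H rnw dom L s R) {j : ℕ} {c : Lab d} (hc : c ∈ H.comp j) :
    dom j c = orbit L s (H.pgenR rnw j c).lastStep (edomR H rnw dom j c) (j - (H.pgenR rnw j c).lastStep) :=
  (realisesW_pgenR hW hG j c hc).2

/-- disjoint current domains of distinct components transfer to the orbits (`pgenR`, W form) [folklore] -/
theorem disjoint_orbit_of_disjoint_domW (hW : H.WF) (hG : LevelClausesW H rnw dom L s R) {K : ℕ} {c c' : Lab d}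
    (hc : c ∈ H.comp K) (hc' : c' ∈ H.comp K) (hdis : Disjoint (dom K c) (dom K c')) :
    Disjoint (orbit L s (H.pgenR rnw K c).lastStep (edomR H rnw dom K c) (K - (H.pgenR rnw K c).lastStep))
      (orbit L s (H.pgenR rnw K c').lastStep (edomR H rnw dom K c') (K - (H.pgenR rnw K c').lastStep)) := by
  rwa [← dom_eq_orbitW hW hG hc, ← dom_eq_orbitW hW hG hc']

/-- the weakly realised `pgenR` genealogy obeys print's timing discipline at its level [folklore] -/
theorem adm_of_mem_compW (hW : H.WF) (hG : LevelClausesW H rnw dom L s R) {j : ℕ} {c : Lab d} (hc : c ∈ H.comp j) :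
    (H.pgenR rnw j c).Adm j :=
  adm_of_realisesW _ _ (realisesW_of_mem_compR hW hG hc) (H.lastStep_pgenR_le rnw j c)

/-! ## §4 Sanity: the print-exact clauses give the memory-agnostic conclusion, by two routes -/

/-- the W realisation theorem applied through `levelClausesW_of_levelClausesR` [folklore] -/
theorem realisesW_pgenR_of_levelClausesR (hW : H.WF) (hG : LevelClausesR H rnw dom L s R) {j : ℕ} {c : Lab d}
    (hc : c ∈ H.comp j) : RealisesW L s R (H.pgenR rnw j c) (edomR H rnw dom j c) :=
  realisesW_of_mem_compR hW (levelClausesW_of_levelClausesR hG) hc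

/-- the same conclusion by the core's bridge from the print-exact theorem (the two routes agree) [folklore] -/
example (hW : H.WF) (hG : LevelClausesR H rnw dom L s R) {j : ℕ} {c : Lab d} (hc : c ∈ H.comp j) :
    RealisesW L s R (H.pgenR rnw j c) (edomR H rnw dom j c) :=
  realisesW_of_realisesP _ _ (realisesP_of_mem_compR hW hG hc)

end MainW

end

end Summit.QuantumFields.BalabanUV.T4Continuum.HistoryGenealogyRealise
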